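/-
LINE 8 crux K_A ⟨stmt-QuantumFields-27724⟩ `TripleSmallBallMargin`, S10 — THE PER-EIGENANGLE BOUND (LEAD g24).

For every centre-symmetric eigenangle configuration `θ` (`‖tr D_θ/N‖² ≤ 1/10`) the weighted first-link fibre of the triple small
ball satisfies `∏_{j<k}|e^{iθ_j} − e^{iθ_k}|² · (Haar⊗Haar){(X,Y) : S(D_θ,X,Y) ≤ t} ≤ exp(N²((4/5) log t + C))` for `N ≥ N₀`,
`0 < t ≤ t₀`: blocks from the pair profile (collar `M = 2000`, slack `ε = 1/10`), one decoupling level (`symFibre_decoupled`),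
the off-block Gaussian count, the Vandermonde split and the per-block pricing (`blockFactor_le`), then the margin bookkeeping.
YM mass gap NOT touched (barrier-ledger line).
-/
import Summits.QuantumFields.YangMills.Theorems.EguchiKawaiDirectionLadderBlockFactor
import Summits.QuantumFields.YangMills.Theorems.EguchiKawaiDirectionLadderOffBlockEvent
import Summits.QuantumFields.YangMills.Theorems.EguchiKawaiDirectionLadderBlockRelabel
import Summits.QuantumFields.YangMills.Theorems.EguchiKawaiDirectionLadderPairPartition
import Summits.QuantumFields.YangMills.Theorems.EguchiKawaiDirectionLadderTripleSmallBallMarginProfile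
import Summits.QuantumFields.YangMills.Theorems.EguchiKawaiDirectionLadderFirstLinkWeylReduction
import Summits.QuantumFields.YangMills.Theorems.EguchiKawaiDirectionLadderMarginBookkeeping
import Summits.QuantumFields.YangMills.Theorems.EguchiKawaiDirectionLadderPairCounts
import Summits.QuantumFields.YangMills.Theorems.EguchiKawaiDirectionLadderOffBlockCount
import HarnessLib

open MeasureTheory Finset
open scoped Matrix ENNReal BigOperators
open Literature.Barriers.QuantumFields

namespace Summit.QuantumFields.YangMills.Theorems.EguchiKawaiDirectionLadder

open Literature.MathematicalPhysics.QuantumFieldTheory (haarProbability)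
open Literature.LinearAlgebra.Matrix (diagonalTorusHom)

noncomputable section


variable {N m : ℕ}

namespace SymFibreBound

/-! ### Counting glue -/

/-- Products over the labelled blocks are products over `Fin m` through `castSucc`. -/
theorem prod_labelledBlocks_eq (g : Fin (m + 1) → ℝ≥0∞) :
    ∏ c ∈ labelledBlocks m, g c = ∏ c : Fin m, g (Fin.castSucc c) := by
  unfold labelledBlocks
  rw [prod_filter, Fin.prod_univ_castSucc]
  simp only [ne_eq, Fin.castSucc_ne_last, not_false_eq_true, if_true, not_true_eq_false, if_false, mul_one]

/-- `Σ_c C(n_c,2) + B = C(N,2)`: within-block pairs plus the rest are all increasing pairs. -/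
theorem sum_choose_blocks_add_notWithin (ℓ : Fin N → Fin (m + 1)) :
    ∑ c : Fin m, ((univ.filter fun i => ℓ i = Fin.castSucc c).card).choose 2 +
        ((univ : Finset (Fin N × Fin N)).filter
          (fun p => p.1 < p.2 ∧ ¬ (ℓ p.1 = ℓ p.2 ∧ ℓ p.1 ≠ Fin.last m))).card = N.choose 2 := by
  have h := PairPartition.prod_Ioi_eq_rest_mul_blocks ℓ (fun _ _ => (2 : ℝ))
  have hL : ∏ j : Fin N, ∏ _k ∈ Ioi j, (2 : ℝ) = 2 ^ N.choose 2 := by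
    simp only [prod_const]
    rw [prod_pow_eq_pow_sum, sum_card_Ioi_eq_choose_two]
  have hR : ∀ c : Fin m, ∏ a : Fin (univ.filter fun i => ℓ i = Fin.castSucc c).card, ∏ _b ∈ Ioi a, (2 : ℝ) =
      2 ^ ((univ.filter fun i => ℓ i = Fin.castSucc c).card).choose 2 := fun c => by
    simp only [prod_const]
    rw [prod_pow_eq_pow_sum, sum_card_Ioi_eq_choose_two]
  rw [hL, prod_const] at h
  simp only [hR] at h
  rw [prod_pow_eq_pow_sum, ← pow_add] at h
  have h' : ((2 ^ N.choose 2 : ℕ) : ℝ) = ((2 ^ (((univ : Finset (Fin N × Fin N)).filter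
      (fun p => p.1 < p.2 ∧ ¬ (ℓ p.1 = ℓ p.2 ∧ ℓ p.1 ≠ Fin.last m))).card +
        ∑ c : Fin m, ((univ.filter fun i => ℓ i = Fin.castSucc c).card).choose 2) : ℕ) : ℝ) := by
    push_cast; exact h
  have := Nat.pow_right_injective (le_refl 2) (Nat.cast_injective h')
  omega

/-- The ordered `r`-close pair count is the row sum. -/
theorem card_close_pairs_eq_sum (d : Fin N → ℂ) (r : ℝ) :
    ((univ : Finset (Fin N × Fin N)).filter fun p => ‖d p.1 - d p.2‖ ≤ r).card =
      ∑ j : Fin N, ((univ : Finset (Fin N)).filter fun k => ‖d j - d k‖ ≤ r).card := by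
  rw [card_eq_sum_ones, sum_filter, ← univ_product_univ, sum_product]
  refine sum_congr rfl fun j _ => ?_
  rw [card_eq_sum_ones, sum_filter]

/-- With no labelled block (`m = 0`) everything is collar. -/
theorem card_collar_eq_of_zero (ℓ : Fin N → Fin (0 + 1)) : (univ.filter fun i => ℓ i = Fin.last 0).card = N := by
  rw [filter_true_of_mem fun i _ => Fin.ext (by have := (ℓ i).isLt; rw [Fin.val_last]; omega), card_univ,
    Fintype.card_fin]

/-- `|u − v|² ≤ 4` for unit `u, v`. -/
theorem norm_sub_sq_le_four' {u v : ℂ} (hu : ‖u‖ = 1) (hv : ‖v‖ = 1) : ‖u - v‖ ^ 2 ≤ 4 := by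
  have h : ‖u - v‖ ≤ 2 := by
    calc ‖u - v‖ ≤ ‖u‖ + ‖v‖ := norm_sub_le u v
      _ = 2 := by rw [hu, hv]; norm_num
  nlinarith [norm_nonneg (u - v)]

end SymFibreBound

open SymFibreBound

/-! ### The per-eigenangle bound -/

set_option maxHeartbeats 1600000 in
/-- **The per-eigenangle bound (S10).**  There are `C`, `t₀ > 0`, `N₀` such that for `N ≥ N₀`, `0 < t ≤ t₀` and every
eigenangle configuration `θ` with `‖tr D_θ/N‖² ≤ 1/10`:
`ofReal(∏_{j<k}|e^{iθ_j} − e^{iθ_k}|²) · (Haar⊗Haar)(tripleFibreEvent D_θ t) ≤ ofReal(exp(N²((4/5) log t + C)))`. -/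
theorem symFibre_bound :
    ∃ C t₀ : ℝ, 0 < t₀ ∧ ∃ N₀ : ℕ, ∀ N : ℕ, N₀ ≤ N → ∀ t : ℝ, 0 < t → t ≤ t₀ → ∀ θ : Fin N → ℝ,
      ‖Matrix.trace ((diagonalTorusHom (Fin N) fun j => Circle.exp (θ j) : UN N) : Matrix (Fin N) (Fin N) ℂ) /
          (N : ℂ)‖ ^ 2 ≤ 1 / 10 →
        ENNReal.ofReal (∏ j : Fin N, ∏ k ∈ Finset.Ioi j,
            ‖Complex.exp (θ j * Complex.I) - Complex.exp (θ k * Complex.I)‖ ^ 2) *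
          (haarProbability (UN N)).prod (haarProbability (UN N))
            (tripleFibreEvent (diagonalTorusHom (Fin N) fun j => Circle.exp (θ j)) t) ≤
        ENNReal.ofReal (Real.exp ((N : ℝ) ^ 2 * ((4 / 5) * Real.log t + C))) := by
  classical
  obtain ⟨r, hr, hprof⟩ := centreSymmetricProfile_proof (1 / 10) (1 / 10) (by norm_num) (by norm_num) (by norm_num)
  obtain ⟨m, γ, hγ, hblocks⟩ := BlockRelabel.blocks_from_pair_profile_fin r hr 2000 (by norm_num)
  obtain ⟨Cm, hCm, hoff⟩ := haar_offBlockEvent_le m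
  obtain ⟨κ, hκ, Cρ, hCρ, Cψ, hCψ, n₀, hBF⟩ := BlockFactor.blockFactor_bound (1 / 1000) (by norm_num)
  have hm0 : (0 : ℝ) ≤ m := Nat.cast_nonneg m
  obtain ⟨K, hKdef⟩ : ∃ K : ℝ, K = 8 + (32 * (m : ℝ) * m + 144 * m) / γ := ⟨_, rfl⟩
  have hK1 : 1 ≤ K := by
    rw [hKdef]
    have : 0 ≤ (32 * (m : ℝ) * m + 144 * m) / γ := by positivity
    linarith
  have hK : 0 ≤ K := by linarith
  obtain ⟨A₀, hA₀def⟩ : ∃ A : ℝ, A = Real.log κ + (3 / 2) * Real.log K := ⟨_, rfl⟩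
  obtain ⟨A₁, hA₁def⟩ : ∃ A : ℝ, A = Cρ + Cψ / 2 := ⟨_, rfl⟩
  have hA₀ : 0 ≤ A₀ := by
    rw [hA₀def]
    have h1 := Real.log_nonneg hκ
    have h2 := Real.log_nonneg hK1
    positivity
  have hA₁ : 0 ≤ A₁ := by rw [hA₁def]; positivity
  have hbf := hBF K A₀ A₁ n₀ hK1 le_rfl hA₀def.symm.le hA₁def.symm.le
  obtain ⟨Γ, hΓ⟩ : ∃ G : ℝ, G = Real.log (2 * (m : ℝ) * m / γ) := ⟨_, rfl⟩
  refine ⟨2 * Real.log 4 + 1 + A₀ + A₁ + K + 2 * Cm + |Γ| + Real.log 100, min 1 (γ / (2 * m * m + 1)),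
    lt_min one_pos (by positivity), max 100 (32 * (m + 1) * (n₀ + 1)), ?_⟩
  intro N hN t ht ht₀ θ hθ
  have hN100 : 100 ≤ N := le_trans (le_max_left _ _) hN
  have hNn₀ : 32 * (m + 1) * (n₀ + 1) ≤ N := le_trans (le_max_right _ _) hN
  have hNpos : 0 < N := by omega
  have hNr : (0 : ℝ) < N := by exact_mod_cast hNpos
  have ht1 : t ≤ 1 := le_trans ht₀ (min_le_left _ _)
  have htγ : t ≤ γ / (2 * m * m + 1) := le_trans ht₀ (min_le_right _ _)
  -- phases and the diagonal unitary
  obtain ⟨d, hd_def⟩ : ∃ d : Fin N → ℂ, d = fun j => Complex.exp (θ j * Complex.I) := ⟨_, rfl⟩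
  have hd : ∀ j, ‖d j‖ = 1 := fun j => by rw [hd_def]; exact Complex.norm_exp_ofReal_mul_I (θ j)
  obtain ⟨D, hD_def⟩ : ∃ D : UN N, D = diagonalTorusHom (Fin N) fun j => Circle.exp (θ j) := ⟨_, rfl⟩
  have hD : (D : Matrix (Fin N) (Fin N) ℂ) = Matrix.diagonal d := by
    rw [hD_def, hd_def]; exact SpectralWindow.coe_diagPhases N θ
  have hVd : (∏ j : Fin N, ∏ k ∈ Finset.Ioi j, ‖Complex.exp (θ j * Complex.I) - Complex.exp (θ k * Complex.I)‖ ^ 2) =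
      ∏ j : Fin N, ∏ k ∈ Finset.Ioi j, ‖d j - d k‖ ^ 2 := by rw [hd_def]
  rw [hVd, ← hD_def]
  rw [← hD_def] at hθ
  -- blocks
  obtain ⟨ℓ, hsep, -, hKcol, hXlow⟩ := hblocks N d hd
  -- counts
  obtain ⟨q, hq⟩ : ∃ q : ℕ, q = Fintype.card {i : Fin N // ℓ i = Fin.last m} := ⟨_, rfl⟩
  have hqcard : (univ.filter fun i => ℓ i = Fin.last m).card = q := by rw [hq, Fintype.card_subtype]
  obtain ⟨X, hXdef⟩ : ∃ X : ℕ, X = ((univ : Finset (Fin N × Fin N)).filter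
    (fun p => p.1 < p.2 ∧ ℓ p.1 ≠ ℓ p.2 ∧ ℓ p.1 ≠ Fin.last m ∧ ℓ p.2 ≠ Fin.last m)).card := ⟨_, rfl⟩
  obtain ⟨B, hBdef⟩ : ∃ B : ℕ, B = ((univ : Finset (Fin N × Fin N)).filter
    (fun p => p.1 < p.2 ∧ ¬ (ℓ p.1 = ℓ p.2 ∧ ℓ p.1 ≠ Fin.last m))).card := ⟨_, rfl⟩
  have hqle : (q : ℝ) ≤ N / 2000 := by rw [← hqcard]; exact hKcol
  -- the per-block log (good/bad), as a function of the block size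
  obtain ⟨Λ, hΛ⟩ : ∃ Λ : ℕ → ℝ, Λ = fun k : ℕ =>
      if n₀ ≤ k ∧ 6 * q ≤ k ∧ K * N * t ≤ k then
        (3 / 2) * ((k : ℝ) * ((k : ℝ) - 1) / 2) * (Real.log t + Real.log ((N : ℝ) / k)) +
          ((k : ℝ) * ((k : ℝ) - 1) / 2) * A₀ + (k : ℝ) ^ 2 * A₁ - (3 / 2) * (1 / 1000) * (k : ℝ) ^ 2 * Real.log t +
          5 * q * k * Real.log 100 - 10 * q * k * Real.log t
      else ((k : ℝ) * ((k : ℝ) - 1) / 2) * Real.log 4 := ⟨_, rfl⟩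
  -- `m ≥ 1`
  have hm1 : 1 ≤ m := by
    rcases Nat.eq_zero_or_pos m with hm0' | hmpos
    · exfalso
      subst hm0'
      have hall := card_collar_eq_of_zero ℓ
      rw [hall] at hqcard
      have h1 : (N : ℝ) ≤ N / 2000 := by
        have h2 := hqle
        rw [← hqcard] at h2
        exact h2
      have : (N : ℝ) ≤ 0 := by linarith
      linarith
    · exact hmpos
  have hmr : (1 : ℝ) ≤ m := by exact_mod_cast hm1
  -- the off-block base `m·m·b/N = 2m²t/γ`
  have hb0 : (0 : ℝ) ≤ 2 * N * t / γ := by positivity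
  have hbase : (m : ℝ) * m * (2 * N * t / γ) / N = 2 * m * m / γ * t := by
    field_simp
  have hbase_pos : 0 < 2 * (m : ℝ) * m / γ * t := by positivity
  have hbase_le : 2 * (m : ℝ) * m / γ * t ≤ 1 := by
    have h1 : 2 * (m : ℝ) * m * t ≤ 2 * m * m * (γ / (2 * m * m + 1)) :=
      mul_le_mul_of_nonneg_left htγ (by positivity)
    have h2 : 2 * (m : ℝ) * m * (γ / (2 * m * m + 1)) ≤ γ := by
      rw [mul_div_assoc', div_le_iff₀ (by positivity : (0 : ℝ) < 2 * m * m + 1)]; nlinarith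
    rw [div_mul_eq_mul_div, div_le_one hγ]; linarith
  -- (1) one decoupling level
  have hfib := symFibre_decoupled hNpos ℓ D d hD hd hγ hsep ht
  rw [prod_labelledBlocks_eq, Measure.prod_prod, ← hq] at hfib
  -- (2) the off-block factor
  have hA := hoff N ℓ (2 * N * t / γ) hb0 hNpos (by rw [hbase]; exact hbase_pos) (by rw [hbase]; exact hbase_le)
  rw [hbase, labelPairCount_toOptionLabel, ← hXdef] at hA
  have hexpX : (2 * (m : ℝ) * m / γ * t) ^ (((2 * X : ℕ) : ℝ) / 2) = Real.exp (X * (Γ + Real.log t)) := by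
    rw [show (((2 * X : ℕ) : ℝ) / 2) = ((X : ℕ) : ℝ) by push_cast; ring, Real.rpow_natCast,
      show (X : ℝ) * (Γ + Real.log t) = (X : ℕ) * Real.log (2 * (m : ℝ) * m / γ * t) by
        rw [hΓ, Real.log_mul (by positivity) ht.ne'],
      Real.exp_nat_mul, Real.exp_log hbase_pos]
  rw [hexpX, ← Real.exp_add] at hA
  -- (3) Vandermonde split
  have hx0 : ∀ j k : Fin N, 0 ≤ ‖d j - d k‖ ^ 2 := fun j k => by positivity
  have hx4 : ∀ j k : Fin N, ‖d j - d k‖ ^ 2 ≤ 4 := fun j k => norm_sub_sq_le_four' (hd j) (hd k)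
  have hV := PairPartition.prod_Ioi_le_pow_mul_prod_blocks ℓ (fun j k => ‖d j - d k‖ ^ 2) hx0 hx4
  rw [← hBdef] at hV
  -- (4) per-block factors
  have hblk : ∀ c : Fin m,
      ENNReal.ofReal (∏ a : Fin (univ.filter fun i => ℓ i = Fin.castSucc c).card, ∏ b ∈ Ioi a,
          ‖d ((univ.filter fun i => ℓ i = Fin.castSucc c).orderEmbOfFin rfl a) -
            d ((univ.filter fun i => ℓ i = Fin.castSucc c).orderEmbOfFin rfl b)‖ ^ 2) *
        min (blockRigidityMeasure ℓ d (Fin.castSucc c)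
                (2 * (2 * N * t) + 8 * (m * (2 * N * t / γ))) (2 * q) *
              blockRigidityMeasure ℓ d (Fin.castSucc c)
                (2 * (2 * N * t) + 8 * (m * (2 * N * t / γ))) (2 * q))
          (blockPairMeasure ℓ (Fin.castSucc c)
              (2 * (4 * N * t + 8 * m * m * (2 * N * t / γ)) + 36 * (m * (2 * N * t / γ) + m * (2 * N * t / γ)))
              (2 * q + 2 * (q + q))) ≤
        ENNReal.ofReal (Real.exp (Λ (univ.filter fun i => ℓ i = Fin.castSucc c).card)) := by
    intro c
    have hNt : (0 : ℝ) ≤ N * t := by positivity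
    have hβρ1 : (N : ℝ) * t ≤ 2 * (2 * N * t) + 8 * (m * (2 * N * t / γ)) := by
      have : 0 ≤ 8 * ((m : ℝ) * (2 * N * t / γ)) := by positivity
      nlinarith
    have hβρ2 : 2 * (2 * (N : ℝ) * t) + 8 * (m * (2 * N * t / γ)) ≤ K * N * t := by
      rw [hKdef]
      have h1 : 2 * (2 * (N : ℝ) * t) + 8 * (m * (2 * N * t / γ)) = (4 + 16 * m / γ) * (N * t) := by
        field_simp; ring
      have h2 : (8 + (32 * (m : ℝ) * m + 144 * m) / γ) * N * t = (8 + (32 * (m : ℝ) * m + 144 * m) / γ) * (N * t) := by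
        ring
      rw [h1, h2]
      refine mul_le_mul_of_nonneg_right ?_ hNt
      have : 16 * (m : ℝ) / γ ≤ (32 * (m : ℝ) * m + 144 * m) / γ :=
        div_le_div_of_nonneg_right (by nlinarith) hγ.le
      linarith
    have hβψeq : 2 * (4 * (N : ℝ) * t + 8 * m * m * (2 * N * t / γ)) + 36 * (m * (2 * N * t / γ) + m * (2 * N * t / γ)) =
        K * N * t := by
      rw [hKdef]; field_simp; ring
    have hβψ1 : (N : ℝ) * t ≤
        2 * (4 * (N : ℝ) * t + 8 * m * m * (2 * N * t / γ)) + 36 * (m * (2 * N * t / γ) + m * (2 * N * t / γ)) := by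
      rw [hβψeq]; nlinarith
    have h := hbf N m ℓ d hd (Fin.castSucc c) _ rfl q (2 * q) (2 * q + 2 * (q + q)) (by omega) (by omega) t
      _ _ ht hβρ1 hβρ2 hβψ1 hβψeq.le
    rw [hΛ]
    exact h
  -- (5) assemble
  have h4B : (0 : ℝ) ≤ (4 : ℝ) ^ B := by positivity
  have hVc0 : ∀ c : Fin m, 0 ≤ ∏ a : Fin (univ.filter fun i => ℓ i = Fin.castSucc c).card, ∏ b ∈ Ioi a,
      ‖d ((univ.filter fun i => ℓ i = Fin.castSucc c).orderEmbOfFin rfl a) -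
        d ((univ.filter fun i => ℓ i = Fin.castSucc c).orderEmbOfFin rfl b)‖ ^ 2 :=
    fun c => prod_nonneg fun _ _ => prod_nonneg fun _ _ => by positivity
  calc ENNReal.ofReal (∏ j : Fin N, ∏ k ∈ Finset.Ioi j, ‖d j - d k‖ ^ 2) *
        (haarProbability (UN N)).prod (haarProbability (UN N)) (tripleFibreEvent D t)
      ≤ ENNReal.ofReal ((4 : ℝ) ^ B * ∏ c : Fin m,
            ∏ a : Fin (univ.filter fun i => ℓ i = Fin.castSucc c).card, ∏ b ∈ Ioi a,
              ‖d ((univ.filter fun i => ℓ i = Fin.castSucc c).orderEmbOfFin rfl a) -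
                d ((univ.filter fun i => ℓ i = Fin.castSucc c).orderEmbOfFin rfl b)‖ ^ 2) * _ :=
        mul_le_mul' (ENNReal.ofReal_le_ofReal hV) hfib
    _ = ENNReal.ofReal ((4 : ℝ) ^ B) *
          (∏ c : Fin m, ENNReal.ofReal (∏ a : Fin (univ.filter fun i => ℓ i = Fin.castSucc c).card, ∏ b ∈ Ioi a,
              ‖d ((univ.filter fun i => ℓ i = Fin.castSucc c).orderEmbOfFin rfl a) -
                d ((univ.filter fun i => ℓ i = Fin.castSucc c).orderEmbOfFin rfl b)‖ ^ 2) *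
            min (blockRigidityMeasure ℓ d (Fin.castSucc c)
                    (2 * (2 * N * t) + 8 * (m * (2 * N * t / γ))) (2 * q) *
                  blockRigidityMeasure ℓ d (Fin.castSucc c)
                    (2 * (2 * N * t) + 8 * (m * (2 * N * t / γ))) (2 * q))
              (blockPairMeasure ℓ (Fin.castSucc c)
                  (2 * (4 * N * t + 8 * m * m * (2 * N * t / γ)) + 36 * (m * (2 * N * t / γ) + m * (2 * N * t / γ)))
                  (2 * q + 2 * (q + q)))) *
          (haarProbability (UN N) (offBlockEvent ℓ (2 * N * t / γ)) *
            haarProbability (UN N) (offBlockEvent ℓ (2 * N * t / γ))) := by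
        rw [ENNReal.ofReal_mul h4B, ENNReal.ofReal_prod_of_nonneg fun c _ => hVc0 c, prod_mul_distrib]
        ring
    _ ≤ ENNReal.ofReal ((4 : ℝ) ^ B) *
          (∏ c : Fin m, ENNReal.ofReal (Real.exp (Λ (univ.filter fun i => ℓ i = Fin.castSucc c).card))) *
          (ENNReal.ofReal (Real.exp (Cm * (N : ℝ) ^ 2 + X * (Γ + Real.log t))) *
            ENNReal.ofReal (Real.exp (Cm * (N : ℝ) ^ 2 + X * (Γ + Real.log t)))) := by
        gcongr with c _
        · exact hblk c
    _ = ENNReal.ofReal (Real.exp ((B : ℝ) * Real.log 4 +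
          ∑ c : Fin m, Λ (univ.filter fun i => ℓ i = Fin.castSucc c).card +
          2 * (Cm * (N : ℝ) ^ 2 + X * (Γ + Real.log t)))) := by
        rw [← ENNReal.ofReal_prod_of_nonneg fun c _ => (Real.exp_pos _).le, ← Real.exp_sum,
          ← ENNReal.ofReal_mul (Real.exp_pos _).le, ← ENNReal.ofReal_mul (by positivity),
          ← ENNReal.ofReal_mul (by positivity), show (4 : ℝ) ^ B = Real.exp ((B : ℝ) * Real.log 4) by
            rw [Real.exp_nat_mul, Real.exp_log (by norm_num : (0 : ℝ) < 4)],
          ← Real.exp_add, ← Real.exp_add, ← Real.exp_add]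
        ring_nf
    _ ≤ ENNReal.ofReal (Real.exp ((N : ℝ) ^ 2 * ((4 / 5) * Real.log t +
          (2 * Real.log 4 + 1 + A₀ + A₁ + K + 2 * Cm + |Γ| + Real.log 100)))) := by
        refine ENNReal.ofReal_le_ofReal (Real.exp_le_exp.2 ?_)
        -- the bookkeeping hypotheses
        have hsum : ∑ c : Fin m, (univ.filter fun i => ℓ i = Fin.castSucc c).card + q = N := by
          rw [← hqcard]; exact PairPartition.sum_card_blocks_add_collar ℓ
        have hBle : (B : ℝ) ≤ X + q * N := by
          rw [hBdef, hXdef, ← hqcard]; exact PairPartition.card_not_within_le_real ℓ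
        have hXB : X ≤ B := by rw [hXdef, hBdef]; exact PairCounts.card_crossPairs_le_card_notWithin ℓ
        have hwithin : ∑ c : Fin m, ((univ.filter fun i => ℓ i = Fin.castSucc c).card).choose 2 + B = N.choose 2 := by
          rw [hBdef]; exact sum_choose_blocks_add_notWithin ℓ
        have hclose : (((univ : Finset (Fin N × Fin N)).filter fun p => ‖d p.1 - d p.2‖ ≤ r).card : ℝ) ≤
            (13 / 20) * (N : ℝ) ^ 2 := by
          have hpm := hprof N hNpos D hθ
          have hpm' := pairMass_diagPhases N r θ
          rw [← hD_def] at hpm'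
          rw [hpm', div_le_iff₀ (by positivity)] at hpm
          rw [card_close_pairs_eq_sum]
          push_cast
          have : (∑ j : Fin N, (((univ : Finset (Fin N)).filter fun k => ‖d j - d k‖ ≤ r).card : ℝ)) =
              ∑ j : Fin N, (((univ : Finset (Fin N)).filter fun k =>
                ‖Complex.exp (θ j * Complex.I) - Complex.exp (θ k * Complex.I)‖ ≤ r).card : ℝ) := by
            rw [hd_def]
          rw [this]; linarith
        have hXge : (((N : ℝ) - N / 2000) ^ 2 - (13 / 20) * (N : ℝ) ^ 2) / 2 ≤ X := by
          rw [hXdef]; push_cast at hXlow ⊢; linarith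
        have hn₀ : (m : ℝ) * (n₀ : ℝ) ^ 2 ≤ (N : ℝ) ^ 2 / 1000 := by
          have h1 : (32 : ℝ) * (m + 1) * (n₀ + 1) ≤ N := by exact_mod_cast hNn₀
          have hn0' : (0 : ℝ) ≤ n₀ := Nat.cast_nonneg n₀
          have h2 : (m : ℝ) * (n₀ : ℝ) ^ 2 ≤ ((m : ℝ) + 1) ^ 2 * ((n₀ : ℝ) + 1) ^ 2 := by nlinarith
          have h3 : (0 : ℝ) ≤ 32 * (m + 1) * (n₀ + 1) := by positivity
          nlinarith
        rw [hΛ]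
        exact margin_bookkeeping (fun c => (univ.filter fun i => ℓ i = Fin.castSucc c).card) N q X B n₀
          hK hA₀ hA₁ hCm ht ht1 hN100 hn₀ hsum hqle hBle hXB hwithin hXge

end

end Summit.QuantumFields.YangMills.Theorems.EguchiKawaiDirectionLadder
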